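import Literature.Probability.LatticeModels.TwoPointSupNormMonotone
import Literature.Probability.LatticeModels.MessagerMiracleSole
import Literature.Probability.LatticeModels.SharpnessProofs
import Literature.Probability.LatticeModels.CriticalTwoPointLower
import Literature.AlgebraicTopology.CellComplexes.CubicalTorusHomology
import HarnessLib

/-!
# Stub `stub_boxCapture` of line `diffusive-branch-is-nonsaturation` (crux
# `PrecisionLaplacian.DirectCorrelationStableTail`, stmt-CriticalPhenomena-4799): the centred box
# captures the most two-point mass (Messager–Miracle-Solé)

**Statement** (registered text, = `stub_boxCapture` of the lead's skeleton).  For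
`G = criticalTwoPoint 3 = ⟨σ₀σ_x⟩⁺_{β_c(3)}` (nearest-neighbour Ising model on `ℤ³`), every
`R : ℕ` and every `v ∈ ℤ³`:  `Σ_{z ∈ B_R} G(z + v) ≤ Σ_{z ∈ B_R} G(z)`, `B_R = box 3 R = {−R,…,R}³`.

**Proof.**  Only two facts about `S = twoPointPlus 3 β`, `β ≥ 0`, are used (both proved in the
tree): evenness in each coordinate, `S(x with x_j ↦ −x_j) = S(x)`
(`twoPointPlus_reflection_invariant_holds`), and Messager–Miracle-Solé axis monotonicity,
`S(x + e_i) ≤ S(x)` for `x_i ≥ 0` (`messager_miracleSole_holds`).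
* 1-D lemma (`boxCapture_sum_Icc_shift_le`): if `φ : ℤ → ℝ` is even and non-increasing on `ℕ`,
  then `k ↦ Φ(k) := Σ_{t=-R}^{R} φ(t + k)` is maximal at `k = 0`: by telescoping,
  `Φ(k+1) − Φ(k) = φ(R+1+k) − φ(−R+k)`, which is `≤ 0` for `k ≥ 0` (`|−R+k| ≤ R+1+k`) and `≥ 0`
  for `k ≤ −1` (`|R+1+k| ≤ R−k`); induct up and down from `0`.
* Lift (`boxCapture_sum_box_coord_step`): Fubini in coordinate `i` of the cube
  (`boxCapture_sum_box_eq`, from the tree's `CubicalTorus.sum_piFinset_update`) and the 1-D lemma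
  applied to `t ↦ S(x with x_i ↦ t)` remove the `i`-th component of the shift; do `i = 0, 1, 2`
  (`boxCapture_sum_box_translate_le`).
Finally `criticalTwoPoint 3 = twoPointPlus 3 (criticalBeta 3)` by definition and `β_c(3) ≥ 0`
(`criticalBeta_nonneg`).

Pure theorem file, no definitions, no `sorry`.  References: A. Messager, S. Miracle-Solé,
J. Stat. Phys. 17 (1977) 245 [MessagerMiracleSoleJSP1977]; H. Duminil-Copin, *Lectures on the
Ising and Potts models* (2019), §4.3, Exercise 37 [DuminilCopin2019].
-/

noncomputable section

namespace Summit.CriticalPhenomena.Ising3DConformalLimit.Cruxes.DirectCorrelationStableTail.DiffusiveBranchIsNonsaturation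

open Finset
open scoped BigOperators
open Literature.Probability.LatticeModels

/-! ### The one-dimensional capture lemma -/

/-- Telescoping of a shifted window sum over `{−R,…,R}`:
`Σ_t h(t + (k+1)) = Σ_t h(t + k) + h(R + 1 + k) − h(−R + k)`. [folklore] -/
theorem boxCapture_sum_Icc_shift_succ (h : ℤ → ℝ) (R : ℕ) (k : ℤ) :
    ∑ t ∈ Icc (-(R : ℤ)) R, h (t + (k + 1)) =
      ∑ t ∈ Icc (-(R : ℤ)) R, h (t + k) + h (R + 1 + k) - h (-R + k) := by
  have h1 : ∑ t ∈ Icc (-(R : ℤ)) R, h (t + (k + 1)) =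
      ∑ s ∈ Icc (-(R : ℤ) + 1) (R + 1), h (s + k) := by
    rw [← Finset.map_add_right_Icc, Finset.sum_map]
    refine Finset.sum_congr rfl fun t _ => ?_
    rw [addRightEmbedding_apply, add_right_comm, add_assoc]
  have h2 : ∑ s ∈ Icc (-(R : ℤ)) (R + 1), h (s + k) =
      h (-(R : ℤ) + k) + ∑ s ∈ Icc (-(R : ℤ) + 1) (R + 1), h (s + k) := by
    rw [← Finset.insert_Icc_add_one_left_eq_Icc (a := -(R : ℤ)) (b := (R : ℤ) + 1) (by omega),
      Finset.sum_insert (fun hm => by rw [Finset.mem_Icc] at hm; omega)]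
  have h3 : ∑ s ∈ Icc (-(R : ℤ)) (R + 1), h (s + k) =
      h ((R : ℤ) + 1 + k) + ∑ s ∈ Icc (-(R : ℤ)) R, h (s + k) := by
    rw [← Finset.insert_Icc_right_eq_Icc_add_one (a := -(R : ℤ)) (b := (R : ℤ)) (by omega),
      Finset.sum_insert (fun hm => by rw [Finset.mem_Icc] at hm; omega)]
  linarith

/-- **1-D capture lemma.**  If `φ : ℤ → ℝ` is even and non-increasing on the nonnegative integers,
then among all translates of the window `{−R,…,R}` the centred one carries the most `φ`-mass:
`Σ_{t=-R}^{R} φ(t + k) ≤ Σ_{t=-R}^{R} φ(t)`. [folklore] -/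
theorem boxCapture_sum_Icc_shift_le (φ : ℤ → ℝ) (heven : ∀ t, φ (-t) = φ t)
    (hmono : ∀ t, 0 ≤ t → φ (t + 1) ≤ φ t) (R : ℕ) (k : ℤ) :
    ∑ t ∈ Icc (-(R : ℤ)) R, φ (t + k) ≤ ∑ t ∈ Icc (-(R : ℤ)) R, φ t := by
  -- `φ` is antitone on the nonnegative integers
  have hanti : ∀ a b : ℤ, 0 ≤ a → a ≤ b → φ b ≤ φ a := by
    intro a b ha hab
    induction b, hab using Int.leInduction with
    | base => exact le_rfl
    | succ b hb ih => exact (hmono b (ha.trans hb)).trans ih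
  -- hence radially non-increasing
  have hrad : ∀ s t : ℤ, -t ≤ s → s ≤ t → φ t ≤ φ s := by
    intro s t h1 h2
    rcases le_or_gt 0 s with hs | hs
    · exact hanti s t hs h2
    · rw [← heven s]
      exact hanti (-s) t (by omega) (by omega)
  set Φ : ℤ → ℝ := fun k => ∑ t ∈ Icc (-(R : ℤ)) R, φ (t + k) with hΦ
  have hstep : ∀ k, Φ (k + 1) = Φ k + φ (R + 1 + k) - φ (-R + k) := fun k =>
    boxCapture_sum_Icc_shift_succ φ R k
  have hup : ∀ k, 0 ≤ k → Φ k ≤ Φ 0 := by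
    intro k hk
    induction k, hk using Int.leInduction with
    | base => exact le_rfl
    | succ k hk ih =>
      rw [hstep]
      have := hrad (-R + k) (R + 1 + k) (by omega) (by omega)
      linarith
  have hdown : ∀ k, k ≤ 0 → Φ k ≤ Φ 0 := by
    intro k hk
    induction k, hk using Int.leInductionDown with
    | base => exact le_rfl
    | pred k hk ih =>
      have h := hstep (k - 1)
      rw [sub_add_cancel] at h
      have h2 : φ (-(R : ℤ) + (k - 1)) ≤ φ (R + 1 + (k - 1)) := by
        rw [show -(R : ℤ) + (k - 1) = -(R + 1 - k) by ring, heven]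
        exact hrad _ _ (by omega) (by omega)
      linarith
  have h0 : Φ 0 = ∑ t ∈ Icc (-(R : ℤ)) R, φ t := by simp [hΦ]
  change Φ k ≤ _
  rw [← h0]
  rcases le_or_gt 0 k with hk | hk
  · exact hup k hk
  · exact hdown k hk.le

/-! ### Fubini in one coordinate of the cube -/

/-- Fubini in coordinate `i` of the cube `box 3 R = {−R,…,R}³`: the sum over the cube is the sum
over the slice `{z_i = 0}` of the sums along the `i`-th fibre (the tree's one-coordinate Fubini
lemma `CubicalTorus.sum_piFinset_update` for `piFinset`s). [folklore] -/
theorem boxCapture_sum_box_eq (R : ℕ) (i : Fin 3) (g : Site 3 → ℝ) :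
    ∑ z ∈ box 3 R, g z =
      ∑ w ∈ Fintype.piFinset (Function.update (fun _ : Fin 3 => Icc (-(R : ℤ)) R) i {0}),
        ∑ a ∈ Icc (-(R : ℤ)) R, g (Function.update w i a) := by
  -- Fubini for one coordinate of a `piFinset` is the tree's `CubicalTorus.sum_piFinset_update`
  rw [Literature.AlgebraicTopology.CellComplexes.CubicalTorus.sum_piFinset_update _ i (c := (0 : ℤ))
    (by simp) (Icc (-(R : ℤ)) R) g, Function.update_idem, Function.update_eq_self_iff.mpr rfl]
  rfl

/-! ### Removing one component of the shift -/

/-- **One coordinate step.**  If `F : ℤ³ → ℝ` is even in the `i`-th coordinate and non-increasing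
in `x_i` on `{x_i ≥ 0}`, then for a shift `u` with `u_i = 0`, adding any `i`-th component `k e_i`
to the shift does not increase the mass of the cube: `Σ_{z∈B_R} F(z + u + k e_i) ≤ Σ_{z∈B_R} F(z + u)`.
[cite: MessagerMiracleSoleJSP1977, main theorem (monotonicity of ⟨σ₀σ_x⟩ under reflections)] -/
theorem boxCapture_sum_box_coord_step (F : Site 3 → ℝ) (i : Fin 3)
    (hE : ∀ x : Site 3, F (Function.update x i (-x i)) = F x)
    (hM : ∀ x : Site 3, 0 ≤ x i → F (x + Pi.single i 1) ≤ F x)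
    (R : ℕ) (u : Site 3) (hu : u i = 0) (k : ℤ) :
    ∑ z ∈ box 3 R, F (z + (u + Pi.single i k)) ≤ ∑ z ∈ box 3 R, F (z + u) := by
  have e1 := boxCapture_sum_box_eq R i (fun z : Site 3 => F (z + (u + (Pi.single i k : Site 3))))
  have e2 := boxCapture_sum_box_eq R i (fun z : Site 3 => F (z + u))
  rw [e1, e2]
  refine Finset.sum_le_sum fun w _ => ?_
  have h1 : ∀ a : ℤ, Function.update w i a + (u + (Pi.single i k : Site 3)) =
      Function.update (w + u) i (a + k) := by
    intro a
    funext j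
    by_cases hj : j = i
    · subst hj
      simp [hu]
    · simp [hj]
  have h2 : ∀ a : ℤ, Function.update w i a + u = Function.update (w + u) i a := by
    intro a
    funext j
    by_cases hj : j = i
    · subst hj
      simp [hu]
    · simp [hj]
  simp only [h1, h2]
  refine boxCapture_sum_Icc_shift_le (fun t => F (Function.update (w + u) i t)) ?_ ?_ R k
  · intro t
    have h := hE (Function.update (w + u) i t)
    rwa [Function.update_self, Function.update_idem] at h
  · intro t ht
    have h := hM (Function.update (w + u) i t) (by simpa using ht)
    have h3 : Function.update (w + u) i t + (Pi.single i 1 : Site 3) =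
        Function.update (w + u) i (t + 1) := by
      funext j
      by_cases hj : j = i
      · subst hj
        simp
      · simp [hj]
    rwa [h3] at h

/-! ### Box capture for the plus state at any `β ≥ 0`, and at `β_c(3)` -/

/-- **Box capture for the plus-state two-point function** `S = ⟨σ₀σ_·⟩⁺_{β,0}`, `β ≥ 0`, of the
nearest-neighbour Ising model on `ℤ³`: `Σ_{z∈B_R} S(z + v) ≤ Σ_{z∈B_R} S(z)` for every `R` and `v`
(remove the components of `v` one coordinate at a time by `boxCapture_sum_box_coord_step`, using
MMS axis monotonicity and coordinate-reflection invariance).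
[cite: MessagerMiracleSoleJSP1977, main theorem (monotonicity of ⟨σ₀σ_x⟩ under reflections)]
[cite: DuminilCopin2019, Exercise 37 (4), §4.3] -/
theorem boxCapture_sum_box_translate_le {β : ℝ} (hβ : 0 ≤ β) (R : ℕ) (v : Site 3) :
    ∑ z ∈ box 3 R, twoPointPlus 3 β (z + v) ≤ ∑ z ∈ box 3 R, twoPointPlus 3 β z := by
  have hE : ∀ (i : Fin 3) (x : Site 3),
      twoPointPlus 3 β (Function.update x i (-x i)) = twoPointPlus 3 β x := fun i x =>
    twoPointPlus_reflection_invariant_holds hβ i x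
  have hM : ∀ (i : Fin 3) (x : Site 3), 0 ≤ x i →
      twoPointPlus 3 β (x + Pi.single i 1) ≤ twoPointPlus 3 β x := fun i x hx =>
    messager_miracleSole_holds hβ x i hx
  set e0 : Site 3 := Pi.single (0 : Fin 3) (v 0) with he0
  set e1 : Site 3 := Pi.single (1 : Fin 3) (v 1) with he1
  set e2 : Site 3 := Pi.single (2 : Fin 3) (v 2) with he2
  have hv : v = e2 + e1 + e0 := by
    funext j
    fin_cases j <;> simp [he0, he1, he2]
  have s0 := boxCapture_sum_box_coord_step (twoPointPlus 3 β) 0 (hE 0) (hM 0) R (e2 + e1)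
    (by simp [he1, he2]) (v 0)
  have s1 := boxCapture_sum_box_coord_step (twoPointPlus 3 β) 1 (hE 1) (hM 1) R e2
    (by simp [he2]) (v 1)
  have s2 := boxCapture_sum_box_coord_step (twoPointPlus 3 β) 2 (hE 2) (hM 2) R 0 (by simp) (v 2)
  simp only [zero_add, add_zero] at s2
  rw [hv]
  exact s0.trans (s1.trans s2)

/-- **Stub `stub_boxCapture` (registered signature, verbatim).**  The centred box captures the most
critical two-point mass: `Σ_{z∈B_R} G(z+v) ≤ Σ_{z∈B_R} G(z)` for `G = criticalTwoPoint 3`, every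
`R` and every `v` (`criticalTwoPoint 3 = twoPointPlus 3 (criticalBeta 3)` by definition, and
`β_c(3) ≥ 0`). [cite: MessagerMiracleSoleJSP1977, main theorem (monotonicity of ⟨σ₀σ_x⟩ under reflections)]
[cite: DuminilCopin2019, Exercise 37 (4), §4.3] -/
theorem stub_boxCapture :
    ∀ (R : ℕ) (v : Site 3), ∑ z ∈ box 3 R, criticalTwoPoint 3 (z + v) ≤
      ∑ z ∈ box 3 R, criticalTwoPoint 3 z :=
  fun R v => boxCapture_sum_box_translate_le (criticalBeta_nonneg 3) R v

end Summit.CriticalPhenomena.Ising3DConformalLimit.Cruxes.DirectCorrelationStableTail.DiffusiveBranchIsNonsaturation
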